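import Summits.ValiantsHypothesis.ValiantsHypothesis.Theorems.BarrierLeverPartitionMinorsMooreBenchPeel

/-!
# Route BarrierLever — item 20172 (CPM), benchmark row 14: MC-bench(s = 2) PROVED for every
# height `h ≤ 7` (R1 of planner p1 g18's memo, via Theorem A and the kernel determinants
# `det G_1, …, det G_7 = 1, 1, 1, -1, -16, 1, -64`)

Helper file (`--supports stmt-ValiantsHypothesis-20172`; cell valiant-natproofs, rung V4, 𝒟-side of
door (c), benchmark «row 14», duty (iv) deliverable R1; seat valiant-natproofs-prover gen 14).
Closes NO item; definition-free; axioms standard (`decide` / `decide +kernel`, no `native_decide`).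

* `det_peelMatrix_one` … `det_peelMatrix_seven` — the first stage determinants (memo §3:
  `1, 1, 1, -1, -16, 1, -64`), by kernel evaluation.
* **`mcBenchPairsAt_of_le_seven`** — `MCBenchPairsAt h` for every `h ≤ 7`: for every injective
  enumeration of the `1 + h + C(h,2) ≤ 29` subsets of size `≤ 2`, some complex node table makes the
  Moore–Chow benchmark minor nonsingular (`mcBenchPairsAt_of_peel`).

WHAT THIS IS NOT: MC-bench(2) for all `h` (certified numerically to `h ≤ 182` by the memo, open in
general); nothing on items 20172 / 20195 / 19717, crux stmt-ValiantsHypothesis-14610, or `VP` versus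
`VNP`.
-/

set_option linter.dupNamespace false

namespace Summit.ValiantsHypothesis.ValiantsHypothesis.Theorems.BarrierLever.MoorePeel

/-- `det G_1 = 1`. -/
theorem det_peelMatrix_one : (peelMatrix 1).det = 1 := by decide

/-- `det G_2 = 1`. -/
theorem det_peelMatrix_two : (peelMatrix 2).det = 1 := by decide

/-- `det G_3 = 1`. -/
theorem det_peelMatrix_three : (peelMatrix 3).det = 1 := by decide

/-- `det G_4 = -1`. -/
theorem det_peelMatrix_four : (peelMatrix 4).det = -1 := by decide

/-- `det G_5 = -16` (kernel evaluation). -/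
theorem det_peelMatrix_five : (peelMatrix 5).det = -16 := by decide +kernel

/-- `det G_6 = 1` (kernel evaluation). -/
theorem det_peelMatrix_six : (peelMatrix 6).det = 1 := by decide +kernel

/-- `det G_7 = -64` (kernel evaluation). -/
theorem det_peelMatrix_seven : (peelMatrix 7).det = -64 := by decide +kernel

/-- The stage determinants `det G_i`, `1 ≤ i ≤ 7`, are nonzero. -/
theorem det_peelMatrix_ne_zero_of_le_seven (i : ℕ) (hi : 1 ≤ i) (hi7 : i ≤ 7) :
    (peelMatrix i).det ≠ 0 := by
  interval_cases i
  · rw [det_peelMatrix_one]; decide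
  · rw [det_peelMatrix_two]; decide
  · rw [det_peelMatrix_three]; decide
  · rw [det_peelMatrix_four]; decide
  · rw [det_peelMatrix_five]; decide
  · rw [det_peelMatrix_six]; decide
  · rw [det_peelMatrix_seven]; decide

/-- **MC-bench(s = 2) for every height `h ≤ 7`** (R1 of the memo, through Theorem A). -/
theorem mcBenchPairsAt_of_le_seven (h : ℕ) (hh : h ≤ 7) : MCBenchPairsAt h :=
  mcBenchPairsAt_of_peel h fun i hi hih => det_peelMatrix_ne_zero_of_le_seven i hi (hih.trans hh)

/-- MC-bench(s = 2) at height `4` (`r = 11`). -/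
theorem mcBenchPairsAt_four : MCBenchPairsAt 4 := mcBenchPairsAt_of_le_seven 4 (by norm_num)

/-- MC-bench(s = 2) at height `6` (`r = 22`). -/
theorem mcBenchPairsAt_six : MCBenchPairsAt 6 := mcBenchPairsAt_of_le_seven 6 (by norm_num)

/-- MC-bench(s = 2) at height `7` (`r = 29`). -/
theorem mcBenchPairsAt_seven : MCBenchPairsAt 7 := mcBenchPairsAt_of_le_seven 7 le_rfl

end Summit.ValiantsHypothesis.ValiantsHypothesis.Theorems.BarrierLever.MoorePeel
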